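import Literature.MathematicalPhysics.QuantumFieldTheory.O2CrossingDerivation
import HarnessLib

/-!
# Non-vacuity of the `O(2)` three-scalar crossing system: decoupled generalised free fields solve it

Topic: `Literature/MathematicalPhysics/QuantumFieldTheory` (conformal bootstrap; verifier-B / `certsdp` client path
of the ENGINES group).  HONEST FRAMING: shared numerical engines serving client cells; rigour lives in the verifiers;
every published number belongs to a client cell's ledger, not to the engines group.  A Literature module: published
statements re-proved in the kernel over the tree's own objects — no named facts, no `sorry`, nothing numerical.

## Why this file

`O2CrossingDerivation.lean` derives the 22 crossing equations of Chester–Landry–Liu–Poland–Simmons-Duffin–Su–Vichi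
(JHEP 06 (2020) 142, App. «Crossing vectors») from crossing symmetry of the fifteen flavoured orderings of
`⟨s s s s⟩, …, ⟨φφst⟩` in the quoted tensor structures of App. «Tensor structures» (`O2CrossingAt`, `derivedVec`,
`o2CrossingAt_iff_derivedVec`), and `O2ThreeScalarCrossing.false_of_pointFunctional₂₂` turns positivity of a functional
on that system into an exclusion.  Such a system is only as trustworthy as it is CONSISTENT: a sign or factor slip in
one tensor structure would make the 22 rows jointly unsatisfiable by any CFT data and every "exclusion" vacuous.
The source review states the standard remedy: *"it is common to check the numerical algorithms against the known
explicit solutions to exclude coding errors"* — the explicit solutions in `d > 2` being the gaussian / mean-field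
(generalised free) theories, whose *"correlation functions … have the same disconnected structure generated by
Wick's theorem"* [PolandRychkovVichi2019, §3.9.1 «Explicit solutions to crossing»].  This file is that check for the
typed `O(2)` system, at the level of FUNCTIONS of the cross-ratios (no conformal block expansion is needed or used):
the `O(2)`-covariant mean-field data consisting of three mutually independent generalised free fields — a charge-1
doublet `φ` of dimension `Δφ`, a real singlet `s` of dimension `Δs` and a charge-2 field `t` of dimension `Δt` —
solve all fifteen flavoured crossing equations, hence all 22 rows, identically in `(Δs, Δφ, Δt)` and at every point
`u, v > 0` (`o2CrossingAt_gff`, `derivedVec_gff`); and the same data with the sign of the `0⁻` channel of `⟨φφφφ⟩`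
reversed violate crossing (`not_crossingAt_flip`), so the witness is sensitive to the sign conventions it controls.

## Sources (read from the held texts) and dictionary

* D. Poland, S. Rychkov, A. Vichi, *The conformal bootstrap: theory, numerical techniques, and applications*,
  Rev. Mod. Phys. 91 (2019) 015002, arXiv:1805.04405 [PolandRychkovVichi2019], §3.9.1 «Explicit solutions to
  crossing» (held text `paper:arxiv-1805.04405`, pp. 24–25):
  > Essentially all explicit solutions in `d>2` are provided by scale-invariant "gaussian theories" […] The
  > correlation functions of such theories are generated by Wick's theorem from the basic 2pt function of the
  > fundamental field. […] Another class of gaussian theories are mean field theories (MFTs), also called generalized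
  > free fields. Correlation functions in these theories have the same disconnected structure generated by Wick's
  > theorem as in the above mentioned free theories. The only difference is that the scaling dimension of the
  > fundamental field, fixed to a particular value in free theories, becomes a free parameter in MFT. […] Although
  > relatively trivial and nonlocal, MFTs satisfy most CFT axioms (except for the existence of a local stress tensor).
* J. Henriksson, M. van Loon, arXiv:1801.03512 [HenrikssonVanLoon2018], §2: the generalised free `O(N)`-vector
  correlator `𝒢^{(0)}_{ijkl} = δᵢⱼδₖₗ + u^{Δφ} δᵢₖδⱼₗ + (u/v)^{Δφ} δᵢₗδⱼₖ` (the `⟨φφφφ⟩` entry below is its `N = 2` case).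
* S. M. Chester et al., JHEP 06 (2020) 142, arXiv:1912.03324 [ChesterEtAl2020], §2.1 (eq. (4point), Table 1) and
  App. «Tensor structures» — the system being tested, as typed in `O2CrossingDerivation` (`Flav`, `S`, `CrossingAt`,
  `derivedVec`).

DICTIONARY (the model data; every item is a definition of this file, not a claim about the source).
(a) Two-point flavour factors in the variables `w_i = y_i·e`, `w̄_i = y_i·ē` of App. «Tensor structures»: for the
doublet `y_i·y_j = w_iw̄_j + w̄_iw_j` (`pair`), for the charge-2 field `(y_i·y_j)²`, for the singlet `1`; fields of
different species, being independent, have vanishing two-point functions.  (b) Wick's theorem: the four-point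
function of the ordering `(𝒪₁,𝒪₂,𝒪₃,𝒪₄)` is the sum over the pairings `(12)(34)`, `(13)(24)`, `(14)(23)` that pair
equal species of (flavour factor) × (product of two-point functions); stripped of the kinematical prefactor of the
mixed crossing equation (`ONMixedSumRule.MixedCrossingAt`: `x₁₂^{−Δ₁−Δ₂} x₃₄^{−Δ₃−Δ₄} (x₂₄/x₁₄)^{Δ₁₂} (x₁₄/x₁₃)^{Δ₃₄}`)
the three products of two-point functions are the functions `1`, `u^{(Δ₁+Δ₂)/2}` and `u^{(Δ₁+Δ₂)/2} v^{−Δ₂}` of the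
cross-ratios (for `⟨φφφφ⟩`: `1, u^{Δφ}, (u/v)^{Δφ}`, Henriksson–van Loon's three terms).  (c) Expanding each flavour
factor in the quoted tensor structures on the admissible set `w_iw̄_i = 0` gives the channel sums `gffSums`
(§2); §3 PROVES that with these channel sums the flavoured `s`-channel sum `S` of `O2CrossingDerivation` equals the
Wick sum of (b) for every ordering (`S_gff_φφφφ`, …, `S_gff_φφst`), so (c) is checked, not posited.

## What is proved

* §3 `S_gff_<L>` (fifteen orderings): on admissible configurations the typed flavoured correlator with channel sums
  `gffSums D` IS the Wick sum — e.g. `S_{φφφφ} = (y₁·y₂)(y₃·y₄) + u^{Δφ}(y₁·y₃)(y₂·y₄) + (u/v)^{Δφ}(y₁·y₄)(y₂·y₃)`,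
  `S_{tφtφ} = u^{(Δφ+Δt)/2} (y₁·y₃)²(y₂·y₄)`, `S_{φsφt} = 0`.
* §4 `derivedVec_gff`: all 22 derived rows vanish on `gffSums D` at every `u, v > 0`, for every `D = (Δs, Δφ, Δt)`;
  `o2CrossingAt_gff`: hence (by `o2CrossingAt_iff_derivedVec`) all fifteen flavoured crossing equations hold — the
  typed system admits this three-parameter family of exact solutions, so no theorem of the form
  "crossing ⟹ False" can be derived from the rows alone.
* §5 `not_crossingAt_flip`: reversing the sign of the `0⁻` channel of `⟨φφφφ⟩` (equivalently of the structure
  `T^{0⁻}_{φφφφ}`) in the same data breaks crossing of `⟨φφφφ⟩` at `(u,v) = (1/4, 1/2)` whenever `Δφ ≠ 0`.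

HONEST LIMITS.  Function-level only: no conformal block decomposition of the mean-field correlators with unequal
external dimensions is in the tree, so nothing here speaks to the positivity hypotheses of
`false_of_pointFunctional₂₂`, to `O2ThreeScalarSystem.O2Data` or to any certificate; the three generalised free
fields are mutually DECOUPLED (`λ_{φφs} = λ_{φφ̄t} = 0`, `⟨φφst⟩ ≡ 0`) and their spectrum violates the gap
assumptions of [ChesterEtAl2020, §2.2] (e.g. a charge-0 scalar of dimension `2Δφ`), so this is a control for the
crossing SYSTEM and its sign conventions, not a candidate point of the `O(2)` island.  Nothing numerical.

## References
* D. Poland, S. Rychkov, A. Vichi, Rev. Mod. Phys. 91 (2019) 015002, arXiv:1805.04405, §3.9.1. [cite: PolandRychkovVichi2019]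
* J. Henriksson, M. van Loon, J. Phys. A 52 (2019) 025401, arXiv:1801.03512, §2. [cite: HenrikssonVanLoon2018]
* S. M. Chester, W. Landry, J. Liu, D. Poland, D. Simmons-Duffin, N. Su, A. Vichi, JHEP 06 (2020) 142,
  arXiv:1912.03324, §2.1, §2.2, App. «Tensor structures». [cite: ChesterEtAl2020]
-/

noncomputable section

open Literature.MathematicalPhysics.QuantumFieldTheory.ONVectorSumRule
open Literature.MathematicalPhysics.QuantumFieldTheory.ONMixedSumRule
open Literature.MathematicalPhysics.QuantumFieldTheory.O2ThreeScalarCrossing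
open Literature.MathematicalPhysics.QuantumFieldTheory.O2CrossingDerivation

namespace Literature.MathematicalPhysics.QuantumFieldTheory.O2CrossingNonVacuity

/-! ## 1. Two-point flavour factors (Wick pairings) -/

/-- The doublet's two-point flavour factor between positions `0` and `1`: `y₁·y₂ = w₀w̄₁ + w̄₀w₁`.
[cite: ChesterEtAl2020, App. «Tensor structures» (`w_i = y_i·e`, `w̄_i = y_i·ē`)] -/
def pair01 (c : Flav) : ℝ := c.w0 * c.b1 + c.b0 * c.w1
/-- `y₁·y₃ = w₀w̄₂ + w̄₀w₂`. [cite: ChesterEtAl2020, App. «Tensor structures»] -/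
def pair02 (c : Flav) : ℝ := c.w0 * c.b2 + c.b0 * c.w2
/-- `y₁·y₄ = w₀w̄₃ + w̄₀w₃`. [cite: ChesterEtAl2020, App. «Tensor structures»] -/
def pair03 (c : Flav) : ℝ := c.w0 * c.b3 + c.b0 * c.w3
/-- `y₂·y₃ = w₁w̄₂ + w̄₁w₂`. [cite: ChesterEtAl2020, App. «Tensor structures»] -/
def pair12 (c : Flav) : ℝ := c.w1 * c.b2 + c.b1 * c.w2
/-- `y₂·y₄ = w₁w̄₃ + w̄₁w₃`. [cite: ChesterEtAl2020, App. «Tensor structures»] -/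
def pair13 (c : Flav) : ℝ := c.w1 * c.b3 + c.b1 * c.w3
/-- `y₃·y₄ = w₂w̄₃ + w̄₂w₃`. [cite: ChesterEtAl2020, App. «Tensor structures»] -/
def pair23 (c : Flav) : ℝ := c.w2 * c.b3 + c.b2 * c.w3

/-! ## 2. The channel sums of three decoupled generalised free fields -/

/-- The 22 channel sums `𝒢^{L}_{R}(u,v)` of the mean-field data (doublet `φ` of dimension `Δφ`, singlet `s` of
dimension `Δs`, charge-2 field `t` of dimension `Δt`, mutually independent), obtained by expanding the Wick sums in
the quoted tensor structures (DICTIONARY (a)–(c); proved to reproduce the Wick sums in §3):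
`⟨φφφφ⟩: 𝒢_{0⁺} = 1 + (u^{Δφ} + (u/v)^{Δφ})/2, 𝒢_{0⁻} = (u^{Δφ} − (u/v)^{Δφ})/2, 𝒢_{2} = u^{Δφ} + (u/v)^{Δφ}`
(likewise `⟨tttt⟩` with `Δt` and charge `4`); `⟨ssss⟩: 1 + u^{Δs} + (u/v)^{Δs}`; `⟨φφss⟩, ⟨ttss⟩, ⟨ttφφ⟩_{0⁺}: 1`;
`⟨ttφφ⟩_{0⁻}: 0`; `⟨tφtφ⟩_{1} = ⟨tφtφ⟩_{3} = u^{(Δφ+Δt)/2}`; `⟨φttφ⟩_{1} = ⟨φttφ⟩_{3} = u^{(Δφ+Δt)/2} v^{−Δt}`;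
`⟨φsφs⟩: u^{(Δφ+Δs)/2}`; `⟨sφφs⟩: u^{(Δφ+Δs)/2} v^{−Δφ}`; `⟨tsts⟩: u^{(Δs+Δt)/2}`; `⟨stts⟩: u^{(Δs+Δt)/2} v^{−Δt}`;
`⟨φsφt⟩, ⟨sφφt⟩, ⟨φφst⟩: 0`.
[cite: PolandRychkovVichi2019, §3.9.1 (mean field theory: Wick's theorem)] [cite: HenrikssonVanLoon2018, §2 (`𝒢^{(0)}_{ijkl}`)] -/
def gffSums (D : Dims) : Sec → ℝ → ℝ → ℝ
  | .φφφφ0p, u, v => 1 + (u ^ D.Δφ + u ^ D.Δφ / v ^ D.Δφ) / 2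
  | .φφφφ0m, u, v => (u ^ D.Δφ - u ^ D.Δφ / v ^ D.Δφ) / 2
  | .φφφφ2, u, v => u ^ D.Δφ + u ^ D.Δφ / v ^ D.Δφ
  | .tttt0p, u, v => 1 + (u ^ D.Δt + u ^ D.Δt / v ^ D.Δt) / 2
  | .tttt0m, u, v => (u ^ D.Δt - u ^ D.Δt / v ^ D.Δt) / 2
  | .tttt4, u, v => u ^ D.Δt + u ^ D.Δt / v ^ D.Δt
  | .ssss0p, u, v => 1 + u ^ D.Δs + u ^ D.Δs / v ^ D.Δs
  | .φφss0p, _, _ => 1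
  | .sφφs1, u, v => u ^ ((D.Δφ + D.Δs) / 2) / v ^ D.Δφ
  | .φsφs1, u, _ => u ^ ((D.Δφ + D.Δs) / 2)
  | .ttss0p, _, _ => 1
  | .stts2, u, v => u ^ ((D.Δs + D.Δt) / 2) / v ^ D.Δt
  | .tsts2, u, _ => u ^ ((D.Δs + D.Δt) / 2)
  | .ttφφ0p, _, _ => 1
  | .ttφφ0m, _, _ => 0
  | .φttφ1, u, v => u ^ ((D.Δφ + D.Δt) / 2) / v ^ D.Δt
  | .φttφ3, u, v => u ^ ((D.Δφ + D.Δt) / 2) / v ^ D.Δt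
  | .tφtφ1, u, _ => u ^ ((D.Δφ + D.Δt) / 2)
  | .tφtφ3, u, _ => u ^ ((D.Δφ + D.Δt) / 2)
  | .φφst2, _, _ => 0
  | .sφφt1, _, _ => 0
  | .φsφt1, _, _ => 0

/-! ## 3. Wick's theorem: the flavoured correlators of the fifteen orderings -/

section Wick
variable (D : Dims) {c : Flav} (u v : ℝ)

/-- `⟨φφφφ⟩ = (y₁·y₂)(y₃·y₄) + u^{Δφ}(y₁·y₃)(y₂·y₄) + (u/v)^{Δφ}(y₁·y₄)(y₂·y₃)` (all three pairings) — the
`N = 2` case of `𝒢^{(0)}_{ijkl} = δᵢⱼδₖₗ + u^{Δφ}δᵢₖδⱼₗ + (u/v)^{Δφ}δᵢₗδⱼₖ`.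
[cite: HenrikssonVanLoon2018, §2 (`𝒢^{(0)}_{ijkl}`)] [cite: PolandRychkovVichi2019, §3.9.1 (Wick's theorem)] -/
theorem S_gff_φφφφ (hc : c.Adm) :
    S (gffSums D) .φφφφ c u v =
      pair01 c * pair23 c + u ^ D.Δφ * (pair02 c * pair13 c) + u ^ D.Δφ / v ^ D.Δφ * (pair03 c * pair12 c) := by
  obtain ⟨h0, h1, h2, h3⟩ := hc
  rcases mul_eq_zero.1 h0 with a0 | a0 <;> rcases mul_eq_zero.1 h1 with a1 | a1 <;>
    rcases mul_eq_zero.1 h2 with a2 | a2 <;> rcases mul_eq_zero.1 h3 with a3 | a3 <;>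
    simp only [S, gffSums, Tφφφφ0p, Tφφφφ0m, Tφφφφ2, pair01, pair02, pair03, pair12, pair13, pair23, a0, a1, a2,
      a3] <;> ring

/-- `⟨tttt⟩ = (y₁·y₂)²(y₃·y₄)² + u^{Δt}(y₁·y₃)²(y₂·y₄)² + (u/v)^{Δt}(y₁·y₄)²(y₂·y₃)²` (all three pairings).
[cite: PolandRychkovVichi2019, §3.9.1 (Wick's theorem)] -/
theorem S_gff_tttt (hc : c.Adm) :
    S (gffSums D) .tttt c u v =
      pair01 c ^ 2 * pair23 c ^ 2 + u ^ D.Δt * (pair02 c ^ 2 * pair13 c ^ 2) +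
        u ^ D.Δt / v ^ D.Δt * (pair03 c ^ 2 * pair12 c ^ 2) := by
  obtain ⟨h0, h1, h2, h3⟩ := hc
  rcases mul_eq_zero.1 h0 with a0 | a0 <;> rcases mul_eq_zero.1 h1 with a1 | a1 <;>
    rcases mul_eq_zero.1 h2 with a2 | a2 <;> rcases mul_eq_zero.1 h3 with a3 | a3 <;>
    simp only [S, gffSums, Ttttt0p, Ttttt0m, Ttttt4, pair01, pair02, pair03, pair12, pair13, pair23, a0, a1, a2,
      a3] <;> ring

/-- `⟨ssss⟩ = 1 + u^{Δs} + (u/v)^{Δs}` (all three pairings, trivial flavour).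
[cite: PolandRychkovVichi2019, §3.9.1 (Wick's theorem; MFT of a scalar of arbitrary dimension)] -/
theorem S_gff_ssss : S (gffSums D) .ssss c u v = 1 + u ^ D.Δs + u ^ D.Δs / v ^ D.Δs := by
  simp only [S, gffSums]

/-- `⟨ttφφ⟩ = (y₁·y₂)²(y₃·y₄)` (pairing `(12)(34)` only). [cite: PolandRychkovVichi2019, §3.9.1 (Wick's theorem)] -/
theorem S_gff_ttφφ : S (gffSums D) .ttφφ c u v = pair01 c ^ 2 * pair23 c := by
  simp only [S, gffSums, Tttφφ0p, Tttφφ0m, pair01, pair23]; ring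

/-- `⟨ttss⟩ = (y₁·y₂)²` (pairing `(12)(34)` only). [cite: PolandRychkovVichi2019, §3.9.1 (Wick's theorem)] -/
theorem S_gff_ttss : S (gffSums D) .ttss c u v = pair01 c ^ 2 := by
  simp only [S, gffSums, Tttss0p, pair01]; ring

/-- `⟨φφss⟩ = y₁·y₂` (pairing `(12)(34)` only). [cite: PolandRychkovVichi2019, §3.9.1 (Wick's theorem)] -/
theorem S_gff_φφss : S (gffSums D) .φφss c u v = pair01 c := by
  simp only [S, gffSums, Tφφss0p, pair01]; ring

/-- `⟨tφtφ⟩ = u^{(Δφ+Δt)/2} (y₁·y₃)²(y₂·y₄)` (pairing `(13)(24)` only; `u^{(Δ₁+Δ₂)/2}` with `(Δ₁,Δ₂) = (Δt,Δφ)`).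
[cite: PolandRychkovVichi2019, §3.9.1 (Wick's theorem)] -/
theorem S_gff_tφtφ (hc : c.Adm) : S (gffSums D) .tφtφ c u v = u ^ ((D.Δφ + D.Δt) / 2) * (pair02 c ^ 2 * pair13 c) := by
  obtain ⟨h0, h1, h2, h3⟩ := hc
  rcases mul_eq_zero.1 h0 with a0 | a0 <;> rcases mul_eq_zero.1 h1 with a1 | a1 <;>
    rcases mul_eq_zero.1 h2 with a2 | a2 <;> rcases mul_eq_zero.1 h3 with a3 | a3 <;>
    simp only [S, gffSums, Ttφtφ1, Ttφtφ3, pair02, pair13, a0, a1, a2, a3] <;> ring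

/-- `⟨φttφ⟩ = u^{(Δφ+Δt)/2} v^{−Δt} (y₁·y₄)(y₂·y₃)²` (pairing `(14)(23)` only; `u^{(Δ₁+Δ₂)/2} v^{−Δ₂}` with
`(Δ₁,Δ₂) = (Δφ,Δt)`). [cite: PolandRychkovVichi2019, §3.9.1 (Wick's theorem)] -/
theorem S_gff_φttφ (hc : c.Adm) :
    S (gffSums D) .φttφ c u v = u ^ ((D.Δφ + D.Δt) / 2) / v ^ D.Δt * (pair03 c * pair12 c ^ 2) := by
  obtain ⟨h0, h1, h2, h3⟩ := hc
  rcases mul_eq_zero.1 h0 with a0 | a0 <;> rcases mul_eq_zero.1 h1 with a1 | a1 <;>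
    rcases mul_eq_zero.1 h2 with a2 | a2 <;> rcases mul_eq_zero.1 h3 with a3 | a3 <;>
    simp only [S, gffSums, Tφttφ1, Tφttφ3, pair03, pair12, a0, a1, a2, a3] <;> ring

/-- `⟨φsφs⟩ = u^{(Δφ+Δs)/2} (y₁·y₃)` (pairing `(13)(24)` only). [cite: PolandRychkovVichi2019, §3.9.1 (Wick's theorem)] -/
theorem S_gff_φsφs : S (gffSums D) .φsφs c u v = u ^ ((D.Δφ + D.Δs) / 2) * pair02 c := by
  simp only [S, gffSums, Tφsφs1, pair02]; ring

/-- `⟨sφφs⟩ = u^{(Δφ+Δs)/2} v^{−Δφ} (y₂·y₃)` (pairing `(14)(23)` only; `(Δ₁,Δ₂) = (Δs,Δφ)`).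
[cite: PolandRychkovVichi2019, §3.9.1 (Wick's theorem)] -/
theorem S_gff_sφφs : S (gffSums D) .sφφs c u v = u ^ ((D.Δφ + D.Δs) / 2) / v ^ D.Δφ * pair12 c := by
  simp only [S, gffSums, Tsφφs1, pair12]; ring

/-- `⟨tsts⟩ = u^{(Δs+Δt)/2} (y₁·y₃)²` (pairing `(13)(24)` only). [cite: PolandRychkovVichi2019, §3.9.1 (Wick's theorem)] -/
theorem S_gff_tsts (hc : c.Adm) : S (gffSums D) .tsts c u v = u ^ ((D.Δs + D.Δt) / 2) * pair02 c ^ 2 := by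
  obtain ⟨h0, h1, h2, h3⟩ := hc
  rcases mul_eq_zero.1 h0 with a0 | a0 <;> rcases mul_eq_zero.1 h2 with a2 | a2 <;>
    simp only [S, gffSums, Ttsts2, pair02, a0, a2] <;> ring

/-- `⟨stts⟩ = u^{(Δs+Δt)/2} v^{−Δt} (y₂·y₃)²` (pairing `(14)(23)` only; `(Δ₁,Δ₂) = (Δs,Δt)`).
[cite: PolandRychkovVichi2019, §3.9.1 (Wick's theorem)] -/
theorem S_gff_stts (hc : c.Adm) :
    S (gffSums D) .stts c u v = u ^ ((D.Δs + D.Δt) / 2) / v ^ D.Δt * pair12 c ^ 2 := by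
  obtain ⟨h0, h1, h2, h3⟩ := hc
  rcases mul_eq_zero.1 h1 with a1 | a1 <;> rcases mul_eq_zero.1 h2 with a2 | a2 <;>
    simp only [S, gffSums, Tstts2, pair12, a1, a2] <;> ring

/-- `⟨φsφt⟩ = 0` (no pairing of equal species exists). [cite: PolandRychkovVichi2019, §3.9.1 (Wick's theorem)] -/
theorem S_gff_φsφt : S (gffSums D) .φsφt c u v = 0 := by
  simp only [S, gffSums]; ring

/-- `⟨sφφt⟩ = 0` (no pairing of equal species exists). [cite: PolandRychkovVichi2019, §3.9.1 (Wick's theorem)] -/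
theorem S_gff_sφφt : S (gffSums D) .sφφt c u v = 0 := by
  simp only [S, gffSums]; ring

/-- `⟨φφst⟩ = 0` (the pairing `(12)` is possible but `⟨s t⟩ = 0`). [cite: PolandRychkovVichi2019, §3.9.1 (Wick's theorem)] -/
theorem S_gff_φφst : S (gffSums D) .φφst c u v = 0 := by
  simp only [S, gffSums]; ring

end Wick

/-! ## 4. The 22 derived rows vanish: the system admits the mean-field solutions -/

section Rows
variable (D : Dims) {u v : ℝ}

/-- Row 1 (`⟨φφφφ⟩`, `F_-[𝒢_{0⁺} − 𝒢_{0⁻}]`) vanishes on the mean-field data. [cite: ChesterEtAl2020, App. «Crossing vectors» (row 1)] -/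
private theorem row0 (hu : 0 < u) (hv : 0 < v) : Fm D.Δφ (gffSums D .φφφφ0p - gffSums D .φφφφ0m) u v = 0 := by
  have h1 := (Real.rpow_pos_of_pos hu D.Δφ).ne'; have h2 := (Real.rpow_pos_of_pos hv D.Δφ).ne'
  simp only [Fm, Pi.sub_apply, gffSums]; field_simp; ring
/-- Row 2 vanishes on the mean-field data. [cite: ChesterEtAl2020, App. «Crossing vectors» (row 2)] -/
private theorem row1 (hu : 0 < u) (hv : 0 < v) :
    Fm D.Δφ (gffSums D .φφφφ2) u v + 2 * Fm D.Δφ (gffSums D .φφφφ0m) u v = 0 := by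
  have h1 := (Real.rpow_pos_of_pos hu D.Δφ).ne'; have h2 := (Real.rpow_pos_of_pos hv D.Δφ).ne'
  simp only [Fm, gffSums]; field_simp; ring
/-- Row 3 vanishes on the mean-field data. [cite: ChesterEtAl2020, App. «Crossing vectors» (row 3)] -/
private theorem row2 (hu : 0 < u) (hv : 0 < v) :
    Fp D.Δφ (gffSums D .φφφφ2) u v - Fp D.Δφ (gffSums D .φφφφ0p + gffSums D .φφφφ0m) u v = 0 := by
  have h1 := (Real.rpow_pos_of_pos hu D.Δφ).ne'; have h2 := (Real.rpow_pos_of_pos hv D.Δφ).ne'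
  simp only [Fp, Pi.add_apply, gffSums]; field_simp; ring
/-- Row 4 vanishes on the mean-field data. [cite: ChesterEtAl2020, App. «Crossing vectors» (row 4)] -/
private theorem row3 (hu : 0 < u) (hv : 0 < v) : Fm D.Δt (gffSums D .tttt0p - gffSums D .tttt0m) u v = 0 := by
  have h1 := (Real.rpow_pos_of_pos hu D.Δt).ne'; have h2 := (Real.rpow_pos_of_pos hv D.Δt).ne'
  simp only [Fm, Pi.sub_apply, gffSums]; field_simp; ring
/-- Row 5 vanishes on the mean-field data. [cite: ChesterEtAl2020, App. «Crossing vectors» (row 5)] -/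
private theorem row4 (hu : 0 < u) (hv : 0 < v) :
    Fm D.Δt (gffSums D .tttt4) u v + 2 * Fm D.Δt (gffSums D .tttt0m) u v = 0 := by
  have h1 := (Real.rpow_pos_of_pos hu D.Δt).ne'; have h2 := (Real.rpow_pos_of_pos hv D.Δt).ne'
  simp only [Fm, gffSums]; field_simp; ring
/-- Row 6 vanishes on the mean-field data. [cite: ChesterEtAl2020, App. «Crossing vectors» (row 6)] -/
private theorem row5 (hu : 0 < u) (hv : 0 < v) :
    Fp D.Δt (gffSums D .tttt4) u v - Fp D.Δt (gffSums D .tttt0p + gffSums D .tttt0m) u v = 0 := by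
  have h1 := (Real.rpow_pos_of_pos hu D.Δt).ne'; have h2 := (Real.rpow_pos_of_pos hv D.Δt).ne'
  simp only [Fp, Pi.add_apply, gffSums]; field_simp; ring
/-- Row 7 vanishes on the mean-field data. [cite: ChesterEtAl2020, App. «Crossing vectors» (row 7)] -/
private theorem row6 : Fm ((D.Δφ + D.Δt) / 2) (gffSums D .tφtφ1 + gffSums D .tφtφ3) u v = 0 := by
  simp only [Fm, Pi.add_apply, gffSums]; ring
/-- Row 8 vanishes on the mean-field data. [cite: ChesterEtAl2020, App. «Crossing vectors» (row 8)] -/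
private theorem row7 :
    Fp ((D.Δφ + D.Δt) / 2) (gffSums D .tφtφ1) u v - Fp ((D.Δφ + D.Δt) / 2) (gffSums D .tφtφ3) u v = 0 := by
  simp only [Fp, gffSums]; ring
/-- Row 9 vanishes on the mean-field data. [cite: ChesterEtAl2020, App. «Crossing vectors» (row 9)] -/
private theorem row8 (hu : 0 < u) (hv : 0 < v) :
    Fm ((D.Δφ + D.Δt) / 2) (gffSums D .ttφφ0p + gffSums D .ttφφ0m) u v + Fm D.Δt (gffSums D .φttφ3) u v = 0 := by
  have h1 := (Real.rpow_pos_of_pos hu D.Δt).ne'; have h2 := (Real.rpow_pos_of_pos hv D.Δt).ne'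
  simp only [Fm, Pi.add_apply, gffSums]; field_simp; ring
/-- Row 10 vanishes on the mean-field data. [cite: ChesterEtAl2020, App. «Crossing vectors» (row 10)] -/
private theorem row9 (hu : 0 < u) (hv : 0 < v) :
    Fm ((D.Δφ + D.Δt) / 2) (gffSums D .ttφφ0p - gffSums D .ttφφ0m) u v + Fm D.Δt (gffSums D .φttφ1) u v = 0 := by
  have h1 := (Real.rpow_pos_of_pos hu D.Δt).ne'; have h2 := (Real.rpow_pos_of_pos hv D.Δt).ne'
  simp only [Fm, Pi.sub_apply, gffSums]; field_simp; ring
/-- Row 11 vanishes on the mean-field data. [cite: ChesterEtAl2020, App. «Crossing vectors» (row 11)] -/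
private theorem row10 (hu : 0 < u) (hv : 0 < v) :
    Fp D.Δt (gffSums D .φttφ3) u v - Fp ((D.Δφ + D.Δt) / 2) (gffSums D .ttφφ0p + gffSums D .ttφφ0m) u v = 0 := by
  have h1 := (Real.rpow_pos_of_pos hu D.Δt).ne'; have h2 := (Real.rpow_pos_of_pos hv D.Δt).ne'
  simp only [Fp, Pi.add_apply, gffSums]; field_simp; ring
/-- Row 12 vanishes on the mean-field data. [cite: ChesterEtAl2020, App. «Crossing vectors» (row 12)] -/
private theorem row11 (hu : 0 < u) (hv : 0 < v) :
    Fp D.Δt (gffSums D .φttφ1) u v - Fp ((D.Δφ + D.Δt) / 2) (gffSums D .ttφφ0p - gffSums D .ttφφ0m) u v = 0 := by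
  have h1 := (Real.rpow_pos_of_pos hu D.Δt).ne'; have h2 := (Real.rpow_pos_of_pos hv D.Δt).ne'
  simp only [Fp, Pi.sub_apply, gffSums]; field_simp; ring
/-- Row 13 vanishes on the mean-field data. [cite: ChesterEtAl2020, App. «Crossing vectors» (row 13)] -/
private theorem row12 (hu : 0 < u) (hv : 0 < v) : Fm D.Δs (gffSums D .ssss0p) u v = 0 := by
  have h1 := (Real.rpow_pos_of_pos hu D.Δs).ne'; have h2 := (Real.rpow_pos_of_pos hv D.Δs).ne'
  simp only [Fm, gffSums]; field_simp; ring
/-- Row 14 vanishes on the mean-field data. [cite: ChesterEtAl2020, App. «Crossing vectors» (row 14)] -/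
private theorem row13 : Fm ((D.Δφ + D.Δs) / 2) (gffSums D .φsφs1) u v = 0 := by
  simp only [Fm, gffSums]; ring
/-- Row 15 vanishes on the mean-field data. [cite: ChesterEtAl2020, App. «Crossing vectors» (row 15)] -/
private theorem row14 : Fm ((D.Δs + D.Δt) / 2) (gffSums D .tsts2) u v = 0 := by
  simp only [Fm, gffSums]; ring
/-- Row 16 vanishes on the mean-field data. [cite: ChesterEtAl2020, App. «Crossing vectors» (row 16)] -/
private theorem row15 (hu : 0 < u) (hv : 0 < v) :
    Fm ((D.Δs + D.Δt) / 2) (gffSums D .ttss0p) u v + Fm D.Δt (gffSums D .stts2) u v = 0 := by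
  have h1 := (Real.rpow_pos_of_pos hu D.Δt).ne'; have h2 := (Real.rpow_pos_of_pos hv D.Δt).ne'
  simp only [Fm, gffSums]; field_simp; ring
/-- Row 17 vanishes on the mean-field data. [cite: ChesterEtAl2020, App. «Crossing vectors» (row 17)] -/
private theorem row16 (hu : 0 < u) (hv : 0 < v) :
    Fp ((D.Δs + D.Δt) / 2) (gffSums D .ttss0p) u v - Fp D.Δt (gffSums D .stts2) u v = 0 := by
  have h1 := (Real.rpow_pos_of_pos hu D.Δt).ne'; have h2 := (Real.rpow_pos_of_pos hv D.Δt).ne'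
  simp only [Fp, gffSums]; field_simp; ring
/-- Row 18 vanishes on the mean-field data. [cite: ChesterEtAl2020, App. «Crossing vectors» (row 18)] -/
private theorem row17 (hu : 0 < u) (hv : 0 < v) :
    Fm ((D.Δφ + D.Δs) / 2) (gffSums D .φφss0p) u v + Fm D.Δφ (gffSums D .sφφs1) u v = 0 := by
  have h1 := (Real.rpow_pos_of_pos hu D.Δφ).ne'; have h2 := (Real.rpow_pos_of_pos hv D.Δφ).ne'
  simp only [Fm, gffSums]; field_simp; ring
/-- Row 19 vanishes on the mean-field data. [cite: ChesterEtAl2020, App. «Crossing vectors» (row 19)] -/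
private theorem row18 (hu : 0 < u) (hv : 0 < v) :
    Fp ((D.Δφ + D.Δs) / 2) (gffSums D .φφss0p) u v - Fp D.Δφ (gffSums D .sφφs1) u v = 0 := by
  have h1 := (Real.rpow_pos_of_pos hu D.Δφ).ne'; have h2 := (Real.rpow_pos_of_pos hv D.Δφ).ne'
  simp only [Fp, gffSums]; field_simp; ring
/-- Row 20 vanishes on the mean-field data. [cite: ChesterEtAl2020, App. «Crossing vectors» (row 20)] -/
private theorem row19 : Fm ((D.Δφ + D.Δs) / 2) (gffSums D .φsφt1) u v = 0 := by
  simp only [Fm, gffSums]; ring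
/-- Row 21 vanishes on the mean-field data. [cite: ChesterEtAl2020, App. «Crossing vectors» (row 21)] -/
private theorem row20 : Fm ((D.Δφ + D.Δs) / 2) (gffSums D .φφst2) u v + Fm D.Δφ (gffSums D .sφφt1) u v = 0 := by
  simp only [Fm, gffSums]; ring
/-- Row 22 vanishes on the mean-field data. [cite: ChesterEtAl2020, App. «Crossing vectors» (row 22)] -/
private theorem row21 : Fp D.Δφ (gffSums D .sφφt1) u v - Fp ((D.Δφ + D.Δs) / 2) (gffSums D .φφst2) u v = 0 := by
  simp only [Fp, gffSums]; ring

/-- **Non-vacuity of the 22-row system.** All 22 derived crossing equations of [ChesterEtAl2020] vanish on the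
mean-field data, for every `(Δs, Δφ, Δt)` and every `u, v > 0` — *"explicit solutions to crossing … provided by
… gaussian theories"*. [cite: PolandRychkovVichi2019, §3.9.1 (explicit solutions to crossing: mean field theory)]
[cite: ChesterEtAl2020, App. «Crossing vectors» (the 22 rows)] -/
theorem derivedVec_gff (hu : 0 < u) (hv : 0 < v) : derivedVec D (gffSums D) u v = 0 := by
  funext r
  fin_cases r <;> simp only [derivedVec, Matrix.cons_val_zero', Matrix.cons_val_succ', Pi.zero_apply]
  exacts [row0 D hu hv, row1 D hu hv, row2 D hu hv, row3 D hu hv, row4 D hu hv, row5 D hu hv, row6 D, row7 D,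
    row8 D hu hv, row9 D hu hv, row10 D hu hv, row11 D hu hv, row12 D hu hv, row13 D, row14 D, row15 D hu hv,
    row16 D hu hv, row17 D hu hv, row18 D hu hv, row19 D, row20 D, row21 D]

/-- **The mean-field data solve all fifteen flavoured crossing equations** (for every admissible flavour
configuration, every ordering, every `(Δs, Δφ, Δt)` and every `u, v > 0`): the typed `O(2)` crossing system is
consistent. [cite: PolandRychkovVichi2019, §3.9.1 (MFTs satisfy the CFT axioms except the local stress tensor)]
[cite: ChesterEtAl2020, §2.1 (eq. (4point))] -/
theorem o2CrossingAt_gff (hu : 0 < u) (hv : 0 < v) : O2CrossingAt D (gffSums D) u v :=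
  (o2CrossingAt_iff_derivedVec.2 (derivedVec_gff D hu hv)).1

end Rows

/-! ## 5. Sign probe: the `0⁻` channel with the opposite sign violates crossing -/

section Probe
variable (D : Dims)

/-- The mean-field channel sums with the sign of `𝒢^{φφφφ}_{0⁻}` reversed (equivalently: the structure `T^{0⁻}_{φφφφ}`
taken with the opposite sign); all other channels unchanged. [cite: ChesterEtAl2020, App. «Tensor structures» (`⟨φφφφ⟩`, sign of `T^{0⁻}`)] -/
def flipSums : Sec → ℝ → ℝ → ℝ
  | .φφφφ0p, u, v => gffSums D .φφφφ0p u v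
  | .φφφφ0m, u, v => -gffSums D .φφφφ0m u v
  | .φφφφ2, u, v => gffSums D .φφφφ2 u v
  | .tttt0p, u, v => gffSums D .tttt0p u v
  | .tttt0m, u, v => gffSums D .tttt0m u v
  | .tttt4, u, v => gffSums D .tttt4 u v
  | .ssss0p, u, v => gffSums D .ssss0p u v
  | .φφss0p, u, v => gffSums D .φφss0p u v
  | .sφφs1, u, v => gffSums D .sφφs1 u v
  | .φsφs1, u, v => gffSums D .φsφs1 u v
  | .ttss0p, u, v => gffSums D .ttss0p u v
  | .stts2, u, v => gffSums D .stts2 u v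
  | .tsts2, u, v => gffSums D .tsts2 u v
  | .ttφφ0p, u, v => gffSums D .ttφφ0p u v
  | .ttφφ0m, u, v => gffSums D .ttφφ0m u v
  | .φttφ1, u, v => gffSums D .φttφ1 u v
  | .φttφ3, u, v => gffSums D .φttφ3 u v
  | .tφtφ1, u, v => gffSums D .tφtφ1 u v
  | .tφtφ3, u, v => gffSums D .tφtφ3 u v
  | .φφst2, u, v => gffSums D .φφst2 u v
  | .sφφt1, u, v => gffSums D .sφφt1 u v
  | .φsφt1, u, v => gffSums D .φsφt1 u v

/-- The self-crossed admissible configuration `w₀ = w₂ = 1`, `w̄₁ = w̄₃ = 1` (monomial `w₀w̄₁w₂w̄₃`), on which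
`S_{φφφφ} = 𝒢_{0⁺} − 𝒢_{0⁻}`. [folklore] -/
private def cP : Flav := ⟨1, 0, 1, 0, 0, 1, 0, 1⟩

/-- **Sign probe.** With the `0⁻` sign reversed, crossing of `⟨φφφφ⟩` fails at `(u,v) = (1/4, 1/2)` whenever
`Δφ ≠ 0`: on the configuration `w₀ = w₂ = w̄₁ = w̄₃ = 1` it would force `(1/2)^{Δφ} = (1/4)^{Δφ}`.  So the witness of §4 is
sensitive to the relative sign of `T^{0⁺}` and `T^{0⁻}`. [cite: ChesterEtAl2020, App. «Tensor structures» (`⟨φφφφ⟩`)]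
[cite: PolandRychkovVichi2019, §3.9.1 (checking against explicit solutions to exclude errors)] -/
theorem not_crossingAt_flip (hΔ : D.Δφ ≠ 0) : ¬ CrossingAt D (flipSums D) .φφφφ (1 / 4) (1 / 2) := by
  intro h
  have hc : cP.Adm := by simp [Flav.Adm, cP]
  have e := h cP hc
  simp only [MixedCrossingAt, cross, Dims.expo, S, flipSums, gffSums, Tφφφφ0p, Tφφφφ0m, Tφφφφ2, cP,
    Flav.swap] at e
  have key : (1 / 2 : ℝ) ^ D.Δφ = (1 / 4 : ℝ) ^ D.Δφ := by
    ring_nf at e ⊢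
    linarith
  have := (Real.rpow_left_inj (by norm_num : (0 : ℝ) ≤ 1 / 2) (by norm_num : (0 : ℝ) ≤ 1 / 4) hΔ).1 key
  norm_num at this

end Probe

end Literature.MathematicalPhysics.QuantumFieldTheory.O2CrossingNonVacuity

end
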